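import Summits.AnomalousDissipation.AnomalousDissipation.Theorems.KolmogorovFloor.Negative.FarField
import Literature.Analysis.FunctionSpaces.TorusFourierModes
import Literature.Analysis.FunctionSpaces.TorusFourierSeries
import Literature.Analysis.FunctionSpaces.TorusVectorParseval

/-!
# CHEAP bookkeeping tools (negative side of `TaylorCertificates.KolmogorovFloor`, crux stmt-AnomalousDissipation-15122,
line `digit-frame-closure`, stub CHEAP)

Line lead `prover-line-stmt-AnomalousDissipation-15122-0` (2026-08-16). The quantitative inviscid linear response of the
line (`ResponseStatement` of `TaylorCertificatesKolmogorovFloorResponseDefs`) is turned into CHEAP approximate steady Euler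
states (`CheapStatesStatement`) by the dressed far field `a = s U + b/s` of `Negative/FarField.lean`; this file carries the
two analytic pairing bounds and the real-number (`rpow`) bookkeeping that conversion needs:

* `abs_integral_inner_le_mul_tail` — PARSEVAL WORK BOUND OFF A BALL: if `b` has no Fourier modes in the ball of radius
  `L` and `‖b̂‖ ≤ β` everywhere, then `|∫⟨b, f⟩| ≤ β · Σ_{κ ∉ ball L} ‖f̂ κ‖`;
* `abs_integral_inner_truncate_sub_le` — TRUNCATION-TAIL PAIRING: against a band-limited multiplier `W` of slope
  `max |κ| ‖Ŵ κ‖ ≤ M`, `|∫⟨P_L f − f, W⟩| ≤ M · Σ_{κ ∉ ball L} ‖f̂ κ‖` (`L ≥ 1`);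
* `integral_inner_farField` — the work of the dressed state splits: `∫⟨sU + tb, f⟩ = s∫⟨U,f⟩ + t∫⟨b,f⟩`;
* the five threshold inequalities `cheap_enstrophy_arith`, `cheap_energy_arith`, `cheap_slope_arith`,
  `cheap_work_arith`, `cheap_defect_arith`: every loss is `η^{-1/100}`-sized (`R = √(X2e2)·Cb ≤ Q η^{-1/100}`,
  `ℓ ≤ 2001 η^{-1/400}`) against margins `≥ η^{1/200}`, so ONE symbolic smallness condition
  `10⁸ (Q+1)² (C+1) η^{1/200} ≤ 1` closes all of them (`rpow_le_gap`: `η^e ≤ η^{1/200} η^{e₀}` for `e ≥ e₀ + 1/200`).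

The tail masses `Σ_{κ ∉ ball L} ‖f̂ κ‖` are written as `tsum`s of the indicator-masked family over all of `ℤ³`
(summability is a hypothesis here; the line's TAIL lemma `fourierTail` supplies it with the decay `C/L^q`).
-/

noncomputable section

set_option linter.dupNamespace false

open MeasureTheory Matrix Finset UnitAddTorus
open scoped BigOperators ComplexConjugate InnerProductSpace ENNReal

namespace Summit.AnomalousDissipation.AnomalousDissipation.Theorems.KolmogorovFloor.Response

open Literature.Analysis.FunctionSpaces Literature.Analysis.FluidPDE

/-! ### The two pairing bounds -/

/-- **Parseval work bound off a ball.** If the smooth field `b` has no Fourier modes in the ball of radius `L` and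
all its coefficients have norm `≤ β`, then `|∫⟨b, f⟩| ≤ β · Σ_{κ ∉ ball L} ‖f̂ κ‖` for smooth `f` (Parseval
`∫⟨b,f⟩ = Σ Re⟨b̂ κ, f̂ κ⟩` and `|Re⟨b̂ κ, f̂ κ⟩| ≤ ‖b̂ κ‖ ‖f̂ κ‖`). -/
theorem abs_integral_inner_le_mul_tail {b f : UnitAddTorus (Fin 3) → EuclideanSpace ℝ (Fin 3)}
    (hb : Torus.IsSmooth b) (hf : Torus.IsSmooth f) {L : ℕ} {β : ℝ}
    (hβ : ∀ κ, ‖mFourierCoeff (EuclideanSpace.complexify ∘ b) κ‖ ≤ β)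
    (hball : ∀ κ ∈ Torus.freqBall L, mFourierCoeff (EuclideanSpace.complexify ∘ b) κ = 0)
    (hsum : Summable (fun κ : Fin 3 → ℤ =>
      if κ ∈ Torus.freqBall L then (0 : ℝ) else ‖mFourierCoeff (EuclideanSpace.complexify ∘ f) κ‖)) :
    |∫ x, ⟪b x, f x⟫_ℝ| ≤ β * ∑' κ : Fin 3 → ℤ,
      (if κ ∈ Torus.freqBall L then (0 : ℝ) else ‖mFourierCoeff (EuclideanSpace.complexify ∘ f) κ‖) := by
  have hP := Torus.hasSum_re_inner_mFourierCoeff_complexify (hb.memLp 2) (hf.memLp 2)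
  have hg := hsum.hasSum.mul_left β
  rw [← Real.norm_eq_abs]
  refine HasSum.norm_le_of_bounded hP hg fun κ => ?_
  rw [Real.norm_eq_abs]
  by_cases hκ : κ ∈ Torus.freqBall L
  · rw [hball κ hκ, inner_zero_left, Complex.zero_re, abs_zero, if_pos hκ, mul_zero]
  · rw [if_neg hκ]
    calc |(⟪mFourierCoeff (EuclideanSpace.complexify ∘ b) κ, mFourierCoeff (EuclideanSpace.complexify ∘ f) κ⟫_ℂ).re|
        ≤ ‖⟪mFourierCoeff (EuclideanSpace.complexify ∘ b) κ, mFourierCoeff (EuclideanSpace.complexify ∘ f) κ⟫_ℂ‖ :=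
          Complex.abs_re_le_norm _
      _ ≤ ‖mFourierCoeff (EuclideanSpace.complexify ∘ b) κ‖ * ‖mFourierCoeff (EuclideanSpace.complexify ∘ f) κ‖ :=
          norm_inner_le_norm _ _
      _ ≤ β * ‖mFourierCoeff (EuclideanSpace.complexify ∘ f) κ‖ :=
          mul_le_mul_of_nonneg_right (hβ κ) (norm_nonneg _)

/-- **Truncation-tail pairing.** Against a smooth multiplier `W` with no modes outside the ball of radius `N` and slope
`|κ| ‖Ŵ κ‖ ≤ M` for all `κ`, the truncation error of a smooth `f` at level `L ≥ 1` pairs to at most `M` times the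
coefficient tail of `f` off the ball of radius `L`: `|∫⟨P_L f − f, W⟩| ≤ M · Σ_{κ ∉ ball L} ‖f̂ κ‖` (the error has no
modes in the `L`-ball, coefficient `−f̂ κ` outside, and `‖Ŵ κ‖ ≤ M` off the origin). -/
theorem abs_integral_inner_truncate_sub_le {f W : UnitAddTorus (Fin 3) → EuclideanSpace ℝ (Fin 3)}
    (hf : Torus.IsSmooth f) (hW : Torus.IsSmooth W) {L N : ℕ} (hL : 1 ≤ L) {M : ℝ}
    (hband : ∀ κ, (N : ℝ) ^ 2 < Torus.freqNormSq κ → mFourierCoeff (EuclideanSpace.complexify ∘ W) κ = 0)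
    (hM : ∀ κ, Real.sqrt (Torus.freqNormSq κ) * ‖mFourierCoeff (EuclideanSpace.complexify ∘ W) κ‖ ≤ M)
    (hsum : Summable (fun κ : Fin 3 → ℤ =>
      if κ ∈ Torus.freqBall L then (0 : ℝ) else ‖mFourierCoeff (EuclideanSpace.complexify ∘ f) κ‖)) :
    |∫ x, ⟪Torus.fourierTruncate L f x - f x, W x⟫_ℝ| ≤ M * ∑' κ : Fin 3 → ℤ,
      (if κ ∈ Torus.freqBall L then (0 : ℝ) else ‖mFourierCoeff (EuclideanSpace.complexify ∘ f) κ‖) := by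
  have hPL := Torus.isSmooth_fourierTruncate L f
  have hM0 : 0 ≤ M := by
    have h := hM 0
    have h0 : Torus.freqNormSq (0 : Fin 3 → ℤ) = 0 := by simp [Torus.freqNormSq]
    rw [h0, Real.sqrt_zero, zero_mul] at h
    exact h
  have h := Torus.integral_inner_eq_sum_freqBall ((hPL.sub hf).memLp 2) (hW.memLp 2) hband
  have h' : ∫ x, ⟪Torus.fourierTruncate L f x - f x, W x⟫_ℝ =
      ∑ κ ∈ Torus.freqBall N, (⟪mFourierCoeff (EuclideanSpace.complexify ∘ (Torus.fourierTruncate L f - f)) κ,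
        mFourierCoeff (EuclideanSpace.complexify ∘ W) κ⟫_ℂ).re := h
  have hL1 : (1 : ℝ) ≤ (L : ℝ) ^ 2 := by
    have : (1 : ℝ) ≤ L := by exact_mod_cast hL
    nlinarith
  have hterm : ∀ κ ∈ Torus.freqBall N,
      |(⟪mFourierCoeff (EuclideanSpace.complexify ∘ (Torus.fourierTruncate L f - f)) κ,
        mFourierCoeff (EuclideanSpace.complexify ∘ W) κ⟫_ℂ).re| ≤
      M * (if κ ∈ Torus.freqBall L then (0 : ℝ) else ‖mFourierCoeff (EuclideanSpace.complexify ∘ f) κ‖) := by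
    intro κ _
    rw [Torus.mFourierCoeff_fourierTruncate_sub hf.integrable L κ]
    by_cases hκ : κ ∈ Torus.freqBall L
    · rw [if_pos hκ, if_pos hκ, inner_zero_left, Complex.zero_re, abs_zero, mul_zero]
    · rw [if_neg hκ, if_neg hκ, inner_neg_left, Complex.neg_re, abs_neg]
      have hfar : (L : ℝ) ^ 2 < Torus.freqNormSq κ := Torus.not_mem_freqBall.1 hκ
      have h1 : 1 ≤ Real.sqrt (Torus.freqNormSq κ) := by
        rw [Real.le_sqrt (by norm_num) (by linarith)]
        linarith
      have hWκ : ‖mFourierCoeff (EuclideanSpace.complexify ∘ W) κ‖ ≤ M :=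
        (le_mul_of_one_le_left (norm_nonneg _) h1).trans (hM κ)
      calc |(⟪mFourierCoeff (EuclideanSpace.complexify ∘ f) κ, mFourierCoeff (EuclideanSpace.complexify ∘ W) κ⟫_ℂ).re|
          ≤ ‖⟪mFourierCoeff (EuclideanSpace.complexify ∘ f) κ, mFourierCoeff (EuclideanSpace.complexify ∘ W) κ⟫_ℂ‖ :=
            Complex.abs_re_le_norm _
        _ ≤ ‖mFourierCoeff (EuclideanSpace.complexify ∘ f) κ‖ * ‖mFourierCoeff (EuclideanSpace.complexify ∘ W) κ‖ :=
            norm_inner_le_norm _ _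
        _ ≤ ‖mFourierCoeff (EuclideanSpace.complexify ∘ f) κ‖ * M :=
            mul_le_mul_of_nonneg_left hWκ (norm_nonneg _)
        _ = M * ‖mFourierCoeff (EuclideanSpace.complexify ∘ f) κ‖ := mul_comm _ _
  have hnn : ∀ κ, 0 ≤ (if κ ∈ Torus.freqBall L then (0 : ℝ) else ‖mFourierCoeff (EuclideanSpace.complexify ∘ f) κ‖) :=
    fun κ => by split_ifs <;> positivity
  rw [h']
  calc |∑ κ ∈ Torus.freqBall N, (⟪mFourierCoeff (EuclideanSpace.complexify ∘ (Torus.fourierTruncate L f - f)) κ,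
          mFourierCoeff (EuclideanSpace.complexify ∘ W) κ⟫_ℂ).re|
      ≤ ∑ κ ∈ Torus.freqBall N, |(⟪mFourierCoeff (EuclideanSpace.complexify ∘ (Torus.fourierTruncate L f - f)) κ,
          mFourierCoeff (EuclideanSpace.complexify ∘ W) κ⟫_ℂ).re| := Finset.abs_sum_le_sum_abs _ _
    _ ≤ ∑ κ ∈ Torus.freqBall N,
          M * (if κ ∈ Torus.freqBall L then (0 : ℝ) else ‖mFourierCoeff (EuclideanSpace.complexify ∘ f) κ‖) :=
        Finset.sum_le_sum hterm
    _ = M * ∑ κ ∈ Torus.freqBall N,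
          (if κ ∈ Torus.freqBall L then (0 : ℝ) else ‖mFourierCoeff (EuclideanSpace.complexify ∘ f) κ‖) := by
        rw [Finset.mul_sum]
    _ ≤ M * ∑' κ : Fin 3 → ℤ,
          (if κ ∈ Torus.freqBall L then (0 : ℝ) else ‖mFourierCoeff (EuclideanSpace.complexify ∘ f) κ‖) :=
        mul_le_mul_of_nonneg_left (hsum.sum_le_tsum _ fun κ _ => hnn κ) hM0

/-- A single coefficient off the ball is bounded by the tail mass off the ball. -/
theorem norm_mFourierCoeff_le_tail {f : UnitAddTorus (Fin 3) → EuclideanSpace ℝ (Fin 3)} {L : ℕ} {ξ : Fin 3 → ℤ}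
    (hξ : ξ ∉ Torus.freqBall L)
    (hsum : Summable (fun κ : Fin 3 → ℤ =>
      if κ ∈ Torus.freqBall L then (0 : ℝ) else ‖mFourierCoeff (EuclideanSpace.complexify ∘ f) κ‖)) :
    ‖mFourierCoeff (EuclideanSpace.complexify ∘ f) ξ‖ ≤ ∑' κ : Fin 3 → ℤ,
      (if κ ∈ Torus.freqBall L then (0 : ℝ) else ‖mFourierCoeff (EuclideanSpace.complexify ∘ f) κ‖) := by
  have h := hsum.le_tsum ξ fun κ _ => by split_ifs <;> positivity
  rwa [if_neg hξ] at h

/-- The work of the dressed state splits: `∫⟨sU + tb, f⟩ = s ∫⟨U, f⟩ + t ∫⟨b, f⟩` (smooth fields). -/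
theorem integral_inner_farField {U b f : UnitAddTorus (Fin 3) → EuclideanSpace ℝ (Fin 3)}
    (hU : Torus.IsSmooth U) (hb : Torus.IsSmooth b) (hf : Torus.IsSmooth f) (s t : ℝ) :
    ∫ x, ⟪(s • U + t • b) x, f x⟫_ℝ = s * (∫ x, ⟪U x, f x⟫_ℝ) + t * ∫ x, ⟪b x, f x⟫_ℝ := by
  have h1 : Integrable (fun x => ⟪U x, f x⟫_ℝ) volume := (hU.inner hf).integrable
  have h2 : Integrable (fun x => ⟪b x, f x⟫_ℝ) volume := (hb.inner hf).integrable
  have e : (fun x => ⟪(s • U + t • b) x, f x⟫_ℝ) = fun x => s * ⟪U x, f x⟫_ℝ + t * ⟪b x, f x⟫_ℝ := by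
    funext x
    simp only [Pi.add_apply, Pi.smul_apply, inner_add_left, inner_smul_left, conj_trivial]
  rw [e, integral_add (h1.const_mul s) (h2.const_mul t), integral_const_mul, integral_const_mul]

/-! ### The threshold inequalities -/

/-- The margin bookkeeping: for `0 < η ≤ 1` and `e ≥ e₀ + 1/200`, `η^e ≤ η^{1/200} · η^{e₀}`. -/
theorem rpow_le_gap {η e e₀ : ℝ} (hη : 0 < η) (hη1 : η ≤ 1) (he : e₀ + 1 / 200 ≤ e) :
    η ^ e ≤ η ^ (1 / 200 : ℝ) * η ^ e₀ := by
  rw [← Real.rpow_add hη]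
  exact Real.rpow_le_rpow_of_exponent_ge hη hη1 (by linarith)

/-- The single smallness condition absorbs every constant below the master constant `10⁸ (Q+1)² (C+1)`. -/
theorem const_mul_rpow_le_one {η Q C c : ℝ} (hη : 0 < η)
    (hK : 10 ^ 8 * (Q + 1) ^ 2 * (C + 1) * η ^ (1 / 200 : ℝ) ≤ 1) (hc : c ≤ 10 ^ 8 * (Q + 1) ^ 2 * (C + 1)) :
    c * η ^ (1 / 200 : ℝ) ≤ 1 :=
  (mul_le_mul_of_nonneg_right hc (Real.rpow_nonneg hη.le _)).trans hK

/-- The response loss with the logarithm: `R ℓ ≤ 2001 Q η^{-1/100} η^{-1/400}` squared and weighted by `t²/(X2e2) =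
η^{26/25}` is `≤ 2001² Q² η^{203/200}`. -/
theorem sq_mul_sq_mul_rpow_le {η Q R ℓ : ℝ} (hη : 0 < η) (hQ : 0 ≤ Q) (hR0 : 0 ≤ R)
    (hR : R ≤ Q * η ^ (-(1 / 100 : ℝ))) (hℓ0 : 0 ≤ ℓ) (hℓ : ℓ ≤ 2001 * η ^ (-(1 / 400 : ℝ))) :
    R ^ 2 * ℓ ^ 2 * η ^ (26 / 25 : ℝ) ≤ 2001 ^ 2 * Q ^ 2 * η ^ (203 / 200 : ℝ) := by
  have hRl : R * ℓ ≤ Q * η ^ (-(1 / 100 : ℝ)) * (2001 * η ^ (-(1 / 400 : ℝ))) :=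
    mul_le_mul hR hℓ hℓ0 (by positivity)
  have hRl2 : (R * ℓ) ^ 2 ≤ (Q * η ^ (-(1 / 100 : ℝ)) * (2001 * η ^ (-(1 / 400 : ℝ)))) ^ 2 :=
    pow_le_pow_left₀ (by positivity) hRl 2
  have h : (η ^ (-(1 / 100 : ℝ))) ^ 2 * (η ^ (-(1 / 400 : ℝ))) ^ 2 * η ^ (26 / 25 : ℝ) = η ^ (203 / 200 : ℝ) := by
    rw [← Real.rpow_natCast (η ^ (-(1 / 100 : ℝ))), ← Real.rpow_natCast (η ^ (-(1 / 400 : ℝ))),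
      ← Real.rpow_mul hη.le, ← Real.rpow_mul hη.le, ← Real.rpow_add hη, ← Real.rpow_add hη]
    norm_num
  calc R ^ 2 * ℓ ^ 2 * η ^ (26 / 25 : ℝ) = (R * ℓ) ^ 2 * η ^ (26 / 25 : ℝ) := by ring
    _ ≤ (Q * η ^ (-(1 / 100 : ℝ)) * (2001 * η ^ (-(1 / 400 : ℝ)))) ^ 2 * η ^ (26 / 25 : ℝ) :=
        mul_le_mul_of_nonneg_right hRl2 (Real.rpow_nonneg hη.le _)
    _ = 2001 ^ 2 * Q ^ 2 * ((η ^ (-(1 / 100 : ℝ))) ^ 2 * (η ^ (-(1 / 400 : ℝ))) ^ 2 * η ^ (26 / 25 : ℝ)) := by ring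
    _ = 2001 ^ 2 * Q ^ 2 * η ^ (203 / 200 : ℝ) := by rw [h]

/-- **Enstrophy threshold.** `4π² η^{-26/25} + 2 R² (J+1)² η^{26/25} ≤ η^{-11/10}` under the single smallness condition
(`R = √(X2e2) Cb ≤ Q η^{-1/100}`, `J + 1 ≤ 3η⁻¹`). -/
theorem cheap_enstrophy_arith {η Q C R Jr : ℝ} (hη : 0 < η) (hη1 : η ≤ 1) (hQ : 0 ≤ Q) (hC : 0 ≤ C)
    (hK : 10 ^ 8 * (Q + 1) ^ 2 * (C + 1) * η ^ (1 / 200 : ℝ) ≤ 1)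
    (hR0 : 0 ≤ R) (hR : R ≤ Q * η ^ (-(1 / 100 : ℝ))) (hJr0 : 0 ≤ Jr) (hJr : Jr ≤ 3 * η ^ (-(1 : ℝ))) :
    4 * Real.pi ^ 2 * η ^ (-(26 / 25 : ℝ)) + 2 * (R ^ 2 * Jr ^ 2) * η ^ (26 / 25 : ℝ) ≤ η ^ (-(11 / 10 : ℝ)) := by
  have hg : ∀ e : ℝ, 0 ≤ η ^ e := fun e => Real.rpow_nonneg hη.le e
  have hπ : Real.pi ^ 2 ≤ 16 := by nlinarith [Real.pi_le_four, Real.pi_pos]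
  have t1 : 4 * Real.pi ^ 2 * η ^ (-(26 / 25 : ℝ)) ≤ 64 * (η ^ (1 / 200 : ℝ) * η ^ (-(11 / 10 : ℝ))) := by
    have h := rpow_le_gap hη hη1 (show -(11 / 10 : ℝ) + 1 / 200 ≤ -(26 / 25 : ℝ) by norm_num)
    calc 4 * Real.pi ^ 2 * η ^ (-(26 / 25 : ℝ)) ≤ 64 * η ^ (-(26 / 25 : ℝ)) :=
          mul_le_mul_of_nonneg_right (by linarith) (hg _)
      _ ≤ 64 * (η ^ (1 / 200 : ℝ) * η ^ (-(11 / 10 : ℝ))) := mul_le_mul_of_nonneg_left h (by norm_num)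
  have hRJ : R * Jr ≤ Q * η ^ (-(1 / 100 : ℝ)) * (3 * η ^ (-(1 : ℝ))) := mul_le_mul hR hJr hJr0 (by positivity)
  have hRJ2 : (R * Jr) ^ 2 ≤ (Q * η ^ (-(1 / 100 : ℝ)) * (3 * η ^ (-(1 : ℝ)))) ^ 2 :=
    pow_le_pow_left₀ (by positivity) hRJ 2
  have e2 : (Q * η ^ (-(1 / 100 : ℝ)) * (3 * η ^ (-(1 : ℝ)))) ^ 2 * η ^ (26 / 25 : ℝ) =
      9 * Q ^ 2 * η ^ (-(49 / 50 : ℝ)) := by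
    have h : (η ^ (-(1 / 100 : ℝ))) ^ 2 * (η ^ (-(1 : ℝ))) ^ 2 * η ^ (26 / 25 : ℝ) = η ^ (-(49 / 50 : ℝ)) := by
      rw [← Real.rpow_natCast (η ^ (-(1 / 100 : ℝ))), ← Real.rpow_natCast (η ^ (-(1 : ℝ))),
        ← Real.rpow_mul hη.le, ← Real.rpow_mul hη.le, ← Real.rpow_add hη, ← Real.rpow_add hη]
      norm_num
    calc _ = 9 * Q ^ 2 * ((η ^ (-(1 / 100 : ℝ))) ^ 2 * (η ^ (-(1 : ℝ))) ^ 2 * η ^ (26 / 25 : ℝ)) := by ring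
      _ = 9 * Q ^ 2 * η ^ (-(49 / 50 : ℝ)) := by rw [h]
  have t2 : 2 * (R ^ 2 * Jr ^ 2) * η ^ (26 / 25 : ℝ) ≤ 18 * Q ^ 2 * (η ^ (1 / 200 : ℝ) * η ^ (-(11 / 10 : ℝ))) := by
    have h := rpow_le_gap hη hη1 (show -(11 / 10 : ℝ) + 1 / 200 ≤ -(49 / 50 : ℝ) by norm_num)
    calc 2 * (R ^ 2 * Jr ^ 2) * η ^ (26 / 25 : ℝ) = 2 * ((R * Jr) ^ 2 * η ^ (26 / 25 : ℝ)) := by ring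
      _ ≤ 2 * ((Q * η ^ (-(1 / 100 : ℝ)) * (3 * η ^ (-(1 : ℝ)))) ^ 2 * η ^ (26 / 25 : ℝ)) :=
          mul_le_mul_of_nonneg_left (mul_le_mul_of_nonneg_right hRJ2 (hg _)) (by norm_num)
      _ = 18 * Q ^ 2 * η ^ (-(49 / 50 : ℝ)) := by rw [e2]; ring
      _ ≤ 18 * Q ^ 2 * (η ^ (1 / 200 : ℝ) * η ^ (-(11 / 10 : ℝ))) := mul_le_mul_of_nonneg_left h (by positivity)
  have hc : (64 + 18 * Q ^ 2) * η ^ (1 / 200 : ℝ) ≤ 1 := by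
    refine const_mul_rpow_le_one hη hK ?_
    have h1 : (10 : ℝ) ^ 8 * (Q + 1) ^ 2 ≤ 10 ^ 8 * (Q + 1) ^ 2 * (C + 1) :=
      le_mul_of_one_le_right (by positivity) (by linarith)
    nlinarith [sq_nonneg Q]
  calc 4 * Real.pi ^ 2 * η ^ (-(26 / 25 : ℝ)) + 2 * (R ^ 2 * Jr ^ 2) * η ^ (26 / 25 : ℝ)
      ≤ 64 * (η ^ (1 / 200 : ℝ) * η ^ (-(11 / 10 : ℝ))) + 18 * Q ^ 2 * (η ^ (1 / 200 : ℝ) * η ^ (-(11 / 10 : ℝ))) :=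
        add_le_add t1 t2
    _ = (64 + 18 * Q ^ 2) * η ^ (1 / 200 : ℝ) * η ^ (-(11 / 10 : ℝ)) := by ring
    _ ≤ 1 * η ^ (-(11 / 10 : ℝ)) := mul_le_mul_of_nonneg_right hc (hg _)
    _ = η ^ (-(11 / 10 : ℝ)) := one_mul _

/-- **Energy threshold.** `η^{-26/25} + 2 R² ℓ² η^{26/25} ≤ η^{-11/10}` (`ℓ = 1 + log(2J+1) ≤ 2001 η^{-1/400}`). -/
theorem cheap_energy_arith {η Q C R ℓ : ℝ} (hη : 0 < η) (hη1 : η ≤ 1) (hQ : 0 ≤ Q) (hC : 0 ≤ C)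
    (hK : 10 ^ 8 * (Q + 1) ^ 2 * (C + 1) * η ^ (1 / 200 : ℝ) ≤ 1)
    (hR0 : 0 ≤ R) (hR : R ≤ Q * η ^ (-(1 / 100 : ℝ))) (hℓ0 : 0 ≤ ℓ) (hℓ : ℓ ≤ 2001 * η ^ (-(1 / 400 : ℝ))) :
    η ^ (-(26 / 25 : ℝ)) + 2 * (R ^ 2 * ℓ ^ 2) * η ^ (26 / 25 : ℝ) ≤ η ^ (-(11 / 10 : ℝ)) := by
  have hg : ∀ e : ℝ, 0 ≤ η ^ e := fun e => Real.rpow_nonneg hη.le e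
  have t1 : η ^ (-(26 / 25 : ℝ)) ≤ η ^ (1 / 200 : ℝ) * η ^ (-(11 / 10 : ℝ)) :=
    rpow_le_gap hη hη1 (show -(11 / 10 : ℝ) + 1 / 200 ≤ -(26 / 25 : ℝ) by norm_num)
  have t2 : 2 * (R ^ 2 * ℓ ^ 2) * η ^ (26 / 25 : ℝ) ≤
      2 * 2001 ^ 2 * Q ^ 2 * (η ^ (1 / 200 : ℝ) * η ^ (-(11 / 10 : ℝ))) := by
    have h := rpow_le_gap hη hη1 (show -(11 / 10 : ℝ) + 1 / 200 ≤ (203 / 200 : ℝ) by norm_num)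
    have h2 := sq_mul_sq_mul_rpow_le hη hQ hR0 hR hℓ0 hℓ
    calc 2 * (R ^ 2 * ℓ ^ 2) * η ^ (26 / 25 : ℝ) = 2 * (R ^ 2 * ℓ ^ 2 * η ^ (26 / 25 : ℝ)) := by ring
      _ ≤ 2 * (2001 ^ 2 * Q ^ 2 * η ^ (203 / 200 : ℝ)) := mul_le_mul_of_nonneg_left h2 (by norm_num)
      _ = 2 * 2001 ^ 2 * Q ^ 2 * η ^ (203 / 200 : ℝ) := by ring
      _ ≤ 2 * 2001 ^ 2 * Q ^ 2 * (η ^ (1 / 200 : ℝ) * η ^ (-(11 / 10 : ℝ))) :=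
          mul_le_mul_of_nonneg_left h (by positivity)
  have hc : (1 + 2 * 2001 ^ 2 * Q ^ 2) * η ^ (1 / 200 : ℝ) ≤ 1 := by
    refine const_mul_rpow_le_one hη hK ?_
    have h1 : (10 : ℝ) ^ 8 * (Q + 1) ^ 2 ≤ 10 ^ 8 * (Q + 1) ^ 2 * (C + 1) :=
      le_mul_of_one_le_right (by positivity) (by linarith)
    nlinarith [sq_nonneg Q]
  calc η ^ (-(26 / 25 : ℝ)) + 2 * (R ^ 2 * ℓ ^ 2) * η ^ (26 / 25 : ℝ)
      ≤ η ^ (1 / 200 : ℝ) * η ^ (-(11 / 10 : ℝ)) + 2 * 2001 ^ 2 * Q ^ 2 * (η ^ (1 / 200 : ℝ) * η ^ (-(11 / 10 : ℝ))) :=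
        add_le_add t1 t2
    _ = (1 + 2 * 2001 ^ 2 * Q ^ 2) * η ^ (1 / 200 : ℝ) * η ^ (-(11 / 10 : ℝ)) := by ring
    _ ≤ 1 * η ^ (-(11 / 10 : ℝ)) := mul_le_mul_of_nonneg_right hc (hg _)
    _ = η ^ (-(11 / 10 : ℝ)) := one_mul _

/-- **Slope threshold.** `η^{-13/25} + R (J+1) η^{13/25} ≤ η^{-3/5}`. -/
theorem cheap_slope_arith {η Q C R Jr : ℝ} (hη : 0 < η) (hη1 : η ≤ 1) (hQ : 0 ≤ Q) (hC : 0 ≤ C)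
    (hK : 10 ^ 8 * (Q + 1) ^ 2 * (C + 1) * η ^ (1 / 200 : ℝ) ≤ 1)
    (hR : R ≤ Q * η ^ (-(1 / 100 : ℝ))) (hJr0 : 0 ≤ Jr) (hJr : Jr ≤ 3 * η ^ (-(1 : ℝ))) :
    η ^ (-(13 / 25 : ℝ)) + R * Jr * η ^ (13 / 25 : ℝ) ≤ η ^ (-(3 / 5 : ℝ)) := by
  have hg : ∀ e : ℝ, 0 ≤ η ^ e := fun e => Real.rpow_nonneg hη.le e
  have t1 : η ^ (-(13 / 25 : ℝ)) ≤ η ^ (1 / 200 : ℝ) * η ^ (-(3 / 5 : ℝ)) :=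
    rpow_le_gap hη hη1 (show -(3 / 5 : ℝ) + 1 / 200 ≤ -(13 / 25 : ℝ) by norm_num)
  have hRJ : R * Jr ≤ Q * η ^ (-(1 / 100 : ℝ)) * (3 * η ^ (-(1 : ℝ))) := mul_le_mul hR hJr hJr0 (by positivity)
  have e2 : Q * η ^ (-(1 / 100 : ℝ)) * (3 * η ^ (-(1 : ℝ))) * η ^ (13 / 25 : ℝ) = 3 * Q * η ^ (-(49 / 100 : ℝ)) := by
    have h : η ^ (-(1 / 100 : ℝ)) * η ^ (-(1 : ℝ)) * η ^ (13 / 25 : ℝ) = η ^ (-(49 / 100 : ℝ)) := by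
      rw [← Real.rpow_add hη, ← Real.rpow_add hη]
      norm_num
    calc _ = 3 * Q * (η ^ (-(1 / 100 : ℝ)) * η ^ (-(1 : ℝ)) * η ^ (13 / 25 : ℝ)) := by ring
      _ = 3 * Q * η ^ (-(49 / 100 : ℝ)) := by rw [h]
  have t2 : R * Jr * η ^ (13 / 25 : ℝ) ≤ 3 * Q * (η ^ (1 / 200 : ℝ) * η ^ (-(3 / 5 : ℝ))) := by
    have h := rpow_le_gap hη hη1 (show -(3 / 5 : ℝ) + 1 / 200 ≤ -(49 / 100 : ℝ) by norm_num)
    calc R * Jr * η ^ (13 / 25 : ℝ) ≤ Q * η ^ (-(1 / 100 : ℝ)) * (3 * η ^ (-(1 : ℝ))) * η ^ (13 / 25 : ℝ) :=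
          mul_le_mul_of_nonneg_right hRJ (hg _)
      _ = 3 * Q * η ^ (-(49 / 100 : ℝ)) := e2
      _ ≤ 3 * Q * (η ^ (1 / 200 : ℝ) * η ^ (-(3 / 5 : ℝ))) := mul_le_mul_of_nonneg_left h (by positivity)
  have hc : (1 + 3 * Q) * η ^ (1 / 200 : ℝ) ≤ 1 := by
    refine const_mul_rpow_le_one hη hK ?_
    have h1 : (10 : ℝ) ^ 8 * (Q + 1) ^ 2 ≤ 10 ^ 8 * (Q + 1) ^ 2 * (C + 1) :=
      le_mul_of_one_le_right (by positivity) (by linarith)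
    nlinarith [sq_nonneg Q]
  calc η ^ (-(13 / 25 : ℝ)) + R * Jr * η ^ (13 / 25 : ℝ)
      ≤ η ^ (1 / 200 : ℝ) * η ^ (-(3 / 5 : ℝ)) + 3 * Q * (η ^ (1 / 200 : ℝ) * η ^ (-(3 / 5 : ℝ))) := add_le_add t1 t2
    _ = (1 + 3 * Q) * η ^ (1 / 200 : ℝ) * η ^ (-(3 / 5 : ℝ)) := by ring
    _ ≤ 1 * η ^ (-(3 / 5 : ℝ)) := mul_le_mul_of_nonneg_right hc (hg _)
    _ = η ^ (-(3 / 5 : ℝ)) := one_mul _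

/-- **Work threshold.** `(η^{-13/25} + R ℓ η^{13/25}) τ ≤ η^{2/5}` for a tail `τ ≤ C η²`. -/
theorem cheap_work_arith {η Q C R ℓ τ : ℝ} (hη : 0 < η) (hη1 : η ≤ 1) (hQ : 0 ≤ Q) (hC : 0 ≤ C)
    (hK : 10 ^ 8 * (Q + 1) ^ 2 * (C + 1) * η ^ (1 / 200 : ℝ) ≤ 1)
    (hR : R ≤ Q * η ^ (-(1 / 100 : ℝ))) (hℓ0 : 0 ≤ ℓ) (hℓ : ℓ ≤ 2001 * η ^ (-(1 / 400 : ℝ)))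
    (hτ0 : 0 ≤ τ) (hτ : τ ≤ C * η ^ (2 : ℝ)) :
    η ^ (-(13 / 25 : ℝ)) * τ + R * ℓ * η ^ (13 / 25 : ℝ) * τ ≤ η ^ (2 / 5 : ℝ) := by
  have hg : ∀ e : ℝ, 0 ≤ η ^ e := fun e => Real.rpow_nonneg hη.le e
  have t1 : η ^ (-(13 / 25 : ℝ)) * τ ≤ C * (η ^ (1 / 200 : ℝ) * η ^ (2 / 5 : ℝ)) := by
    have h := rpow_le_gap hη hη1 (show (2 / 5 : ℝ) + 1 / 200 ≤ (37 / 25 : ℝ) by norm_num)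
    have e : η ^ (-(13 / 25 : ℝ)) * η ^ (2 : ℝ) = η ^ (37 / 25 : ℝ) := by
      rw [← Real.rpow_add hη]; norm_num
    calc η ^ (-(13 / 25 : ℝ)) * τ ≤ η ^ (-(13 / 25 : ℝ)) * (C * η ^ (2 : ℝ)) := mul_le_mul_of_nonneg_left hτ (hg _)
      _ = C * (η ^ (-(13 / 25 : ℝ)) * η ^ (2 : ℝ)) := by ring
      _ = C * η ^ (37 / 25 : ℝ) := by rw [e]
      _ ≤ C * (η ^ (1 / 200 : ℝ) * η ^ (2 / 5 : ℝ)) := mul_le_mul_of_nonneg_left h hC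
  have hRl : R * ℓ ≤ Q * η ^ (-(1 / 100 : ℝ)) * (2001 * η ^ (-(1 / 400 : ℝ))) :=
    mul_le_mul hR hℓ hℓ0 (by positivity)
  have t2 : R * ℓ * η ^ (13 / 25 : ℝ) * τ ≤ 2001 * Q * C * (η ^ (1 / 200 : ℝ) * η ^ (2 / 5 : ℝ)) := by
    have h := rpow_le_gap hη hη1 (show (2 / 5 : ℝ) + 1 / 200 ≤ (1003 / 400 : ℝ) by norm_num)
    have e : η ^ (-(1 / 100 : ℝ)) * η ^ (-(1 / 400 : ℝ)) * η ^ (13 / 25 : ℝ) * η ^ (2 : ℝ) = η ^ (1003 / 400 : ℝ) := by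
      rw [← Real.rpow_add hη, ← Real.rpow_add hη, ← Real.rpow_add hη]; norm_num
    calc R * ℓ * η ^ (13 / 25 : ℝ) * τ
        ≤ Q * η ^ (-(1 / 100 : ℝ)) * (2001 * η ^ (-(1 / 400 : ℝ))) * η ^ (13 / 25 : ℝ) * (C * η ^ (2 : ℝ)) :=
          mul_le_mul (mul_le_mul_of_nonneg_right hRl (hg _)) hτ hτ0 (by positivity)
      _ = 2001 * Q * C * (η ^ (-(1 / 100 : ℝ)) * η ^ (-(1 / 400 : ℝ)) * η ^ (13 / 25 : ℝ) * η ^ (2 : ℝ)) := by ring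
      _ = 2001 * Q * C * η ^ (1003 / 400 : ℝ) := by rw [e]
      _ ≤ 2001 * Q * C * (η ^ (1 / 200 : ℝ) * η ^ (2 / 5 : ℝ)) := mul_le_mul_of_nonneg_left h (by positivity)
  have hc : (C + 2001 * Q * C) * η ^ (1 / 200 : ℝ) ≤ 1 := by
    refine const_mul_rpow_le_one hη hK ?_
    have h1 : 1 + 2001 * Q ≤ (10 : ℝ) ^ 8 * (Q + 1) ^ 2 := by nlinarith [sq_nonneg Q]
    have h2 : C * (1 + 2001 * Q) ≤ (C + 1) * ((10 : ℝ) ^ 8 * (Q + 1) ^ 2) :=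
      mul_le_mul (by linarith) h1 (by positivity) (by positivity)
    linarith
  calc η ^ (-(13 / 25 : ℝ)) * τ + R * ℓ * η ^ (13 / 25 : ℝ) * τ
      ≤ C * (η ^ (1 / 200 : ℝ) * η ^ (2 / 5 : ℝ)) + 2001 * Q * C * (η ^ (1 / 200 : ℝ) * η ^ (2 / 5 : ℝ)) :=
        add_le_add t1 t2
    _ = (C + 2001 * Q * C) * η ^ (1 / 200 : ℝ) * η ^ (2 / 5 : ℝ) := by ring
    _ ≤ 1 * η ^ (2 / 5 : ℝ) := mul_le_mul_of_nonneg_right hc (hg _)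
    _ = η ^ (2 / 5 : ℝ) := one_mul _

/-- **Defect threshold.** `Cb/(J+1)² + τ + R² ℓ² η^{26/25} ≤ η` (edge sites, truncation tail, self-advection). -/
theorem cheap_defect_arith {η Q C R Cb Jr ℓ τ : ℝ} (hη : 0 < η) (hη1 : η ≤ 1) (hQ : 0 ≤ Q) (hC : 0 ≤ C)
    (hK : 10 ^ 8 * (Q + 1) ^ 2 * (C + 1) * η ^ (1 / 200 : ℝ) ≤ 1)
    (hR0 : 0 ≤ R) (hR : R ≤ Q * η ^ (-(1 / 100 : ℝ))) (hCb0 : 0 ≤ Cb) (hCbR : Cb ≤ R)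
    (hJr : η ^ (-(1 : ℝ)) ≤ Jr) (hℓ0 : 0 ≤ ℓ) (hℓ : ℓ ≤ 2001 * η ^ (-(1 / 400 : ℝ)))
    (hτ : τ ≤ C * η ^ (2 : ℝ)) :
    Cb / Jr ^ 2 + τ + R ^ 2 * ℓ ^ 2 * η ^ (26 / 25 : ℝ) ≤ η := by
  have hg : ∀ e : ℝ, 0 ≤ η ^ e := fun e => Real.rpow_nonneg hη.le e
  have hJpos : 0 < η ^ (-(1 : ℝ)) := Real.rpow_pos_of_pos hη _
  have hinv : (η ^ (-(1 : ℝ))) ^ 2 = (η ^ (2 : ℝ))⁻¹ := by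
    rw [← Real.rpow_natCast (η ^ (-(1 : ℝ))), ← Real.rpow_mul hη.le, ← Real.rpow_neg hη.le]
    norm_num
  have t1 : Cb / Jr ^ 2 ≤ Q * (η ^ (1 / 200 : ℝ) * η ^ (1 : ℝ)) := by
    have h := rpow_le_gap hη hη1 (show (1 : ℝ) + 1 / 200 ≤ (199 / 100 : ℝ) by norm_num)
    have e : η ^ (-(1 / 100 : ℝ)) * η ^ (2 : ℝ) = η ^ (199 / 100 : ℝ) := by
      rw [← Real.rpow_add hη]; norm_num
    calc Cb / Jr ^ 2 ≤ Cb / (η ^ (-(1 : ℝ))) ^ 2 :=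
          div_le_div_of_nonneg_left hCb0 (pow_pos hJpos 2) (pow_le_pow_left₀ hJpos.le hJr 2)
      _ = Cb * η ^ (2 : ℝ) := by rw [hinv, div_inv_eq_mul]
      _ ≤ Q * η ^ (-(1 / 100 : ℝ)) * η ^ (2 : ℝ) := mul_le_mul_of_nonneg_right (hCbR.trans hR) (hg _)
      _ = Q * η ^ (199 / 100 : ℝ) := by rw [mul_assoc, e]
      _ ≤ Q * (η ^ (1 / 200 : ℝ) * η ^ (1 : ℝ)) := mul_le_mul_of_nonneg_left h hQ
  have t2 : τ ≤ C * (η ^ (1 / 200 : ℝ) * η ^ (1 : ℝ)) := by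
    have h := rpow_le_gap hη hη1 (show (1 : ℝ) + 1 / 200 ≤ (2 : ℝ) by norm_num)
    exact hτ.trans (mul_le_mul_of_nonneg_left h hC)
  have t3 : R ^ 2 * ℓ ^ 2 * η ^ (26 / 25 : ℝ) ≤ 2001 ^ 2 * Q ^ 2 * (η ^ (1 / 200 : ℝ) * η ^ (1 : ℝ)) := by
    have h := rpow_le_gap hη hη1 (show (1 : ℝ) + 1 / 200 ≤ (203 / 200 : ℝ) by norm_num)
    exact (sq_mul_sq_mul_rpow_le hη hQ hR0 hR hℓ0 hℓ).trans (mul_le_mul_of_nonneg_left h (by positivity))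
  have hc : (Q + C + 2001 ^ 2 * Q ^ 2) * η ^ (1 / 200 : ℝ) ≤ 1 := by
    refine const_mul_rpow_le_one hη hK ?_
    have h1 : Q + 2001 ^ 2 * Q ^ 2 + 1 ≤ (10 : ℝ) ^ 8 * (Q + 1) ^ 2 := by nlinarith [sq_nonneg Q]
    have h2 : (C + 1) * (Q + 2001 ^ 2 * Q ^ 2 + 1) ≤ (C + 1) * ((10 : ℝ) ^ 8 * (Q + 1) ^ 2) :=
      mul_le_mul_of_nonneg_left h1 (by linarith)
    nlinarith
  calc Cb / Jr ^ 2 + τ + R ^ 2 * ℓ ^ 2 * η ^ (26 / 25 : ℝ)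
      ≤ Q * (η ^ (1 / 200 : ℝ) * η ^ (1 : ℝ)) + C * (η ^ (1 / 200 : ℝ) * η ^ (1 : ℝ)) +
          2001 ^ 2 * Q ^ 2 * (η ^ (1 / 200 : ℝ) * η ^ (1 : ℝ)) := add_le_add (add_le_add t1 t2) t3
    _ = (Q + C + 2001 ^ 2 * Q ^ 2) * η ^ (1 / 200 : ℝ) * η ^ (1 : ℝ) := by ring
    _ ≤ 1 * η ^ (1 : ℝ) := mul_le_mul_of_nonneg_right hc (hg _)
    _ = η := by rw [one_mul, Real.rpow_one]

end Summit.AnomalousDissipation.AnomalousDissipation.Theorems.KolmogorovFloor.Response
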